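import Literature.MathematicalPhysics.QuantumFieldTheory.Balaban1983to89.B9Thm311LocalInversePosY

/-!
# `Balaban1983to89.B9Thm311PosViaLocalInversesY` — [B9] THEOREM 3.11 FOR `Δ_a` (p. 416), THE PRINTED PROOF TYPED AS THE DISCHARGE ROAD
# OF THE N06 CERTIFICATE's ROW-17 BINDER `hΔA`: positive definiteness of a symmetric operator from (i) POSITIVITY OF ITS LOCAL CUBE
# INVERSES and (ii) L²-FORM SMALLNESS OF THE LOCALISATION REMAINDER — carrier-generic in print's trace currency, then at def-Y's `Δ_a(U)`

statement-level skeleton of published theorems with citation tags; proofs where landed; nothing here is a claim about the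
Yang–Mills mass gap

T. Bałaban, *Propagators for lattice gauge theories in a background field*, Commun. Math. Phys. **99** (1985) 389–434
[`Balaban1985BackgroundPropagators`, "[B9]"].  PDF held (`paper:balaban1985-cmp99-background-propagators`, journal page = PDF page + 388);
pp. 409, 414–416 re-read by this seat (2026-08-28).

THE PRINT (verbatim, p. 416).  *«Theorem 3.11. Under the assumptions of the Theorems 3.1–3.10 … the operators Δ′_a, G′, (Q′G′²Q′\*)⁻¹, Δ_a,
G are positive definite. This is obvious for the first three operators, and also for P and R, hence it is enough to prove it for G. It
is a symmetric and invertible operator, so if it is not positive, then there exists A₀ ≠ 0, λ₀ > 0 such that GA₀ = −λ₀A₀. By (3.106)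
G = G₀(I − R)⁻¹, R is an operator with small norm. Let us assume that the operator G₀ is positive … This is in contradiction with the
inequality ⟨A, (I − R\*)A⟩ = ⟨A, A⟩ − Re⟨A, RA⟩ ≥ (1 − O(M^{−1/2}))⟨A, A⟩ > 0 holding for M sufficiently large. Thus we have to prove the
positivity of G₀. By the definition (3.87) it is enough to prove a positivity of the operators G_□.»*  (3.87) p. 409: *«G₀ = Σ_{□∈𝒟} h_□G_□h_□»*;
(3.105)–(3.106) p. 414: *«Δ_aG₀ = I − R, G = G₀(I − R)⁻¹»*.

WHY THIS FILE (cell context, pub-ymgap N06 DAG).  Row 17 of the N06 certificate displays `hΔA : ∀ x … U, Reg335 … U → PosDefTr 1 (deltaAY x.toKIdx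
(parSymY …) (parBY …) (GpY …) U)` (edition 26 l.97) — Theorem 3.11's content for `Δ_a`, this lineage's row (bundle F5).  Print proves it NOT by a
direct estimate but by the localisation road quoted above: positivity of the LOCAL cube inverses `G_□(U)` (Sect. B at the local operators, Cor. 3.6)
plus smallness of the walk remainder `R` of (3.105).  With def-Y's FILE 35 (`Node00.OpsYLocalInverse`: `dirPadY P T = P T P + (1 − P)`, `dirInvY P T =
P (dirPadY P T)⁻¹ P`) the local inverses are typed for ANY operator `T`; this file types the whole p. 416 argument for an arbitrary trIP-symmetric
`T` on an arbitrary finite carrier (so it serves the bond sector `Δ_a(U)` on `FBondY i` as well as the site sector), and then reads it at def-Y's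
`Δ_a(U)`: `hΔA(U)` follows from exactly TWO analytic inputs — LOCAL positivity of the cube-compressed `Δ_a(U)` and the L²-form smallness of the
(3.105) remainder — every other ingredient (symmetry of `Δ_a(U)`, the (3.105) identity, the positivity transfer) being a theorem here.

WHAT IS PROVED (sorry-free; 0 `def`; `M_N(ℂ)` fibres; print's pairing `trIP w`, any positive weight `w`).
* §1 ★ THE p. 416 STEP IN GENUINE CURRENCY `posDefTr_of_mul_eq_one_sub`: on any finite carrier, `IsSymmTr w T`, `PosDefTr w G₀`, `T * G₀ = 1 − R` and
  `⟨A, RA⟩_w < ⟨A, A⟩_w` for `A ≠ 0` ⇒ `PosDefTr w T` (transport through `realify311` of the abstract inner-product statement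
  `posDef_of_comp_eq_one_sub`, itself this lineage's sqrt-free eigenvector form `B9Thm311Whole.posDef_of_factor_small` moved from `G` to `Δ = G⁻¹`);
  θ-form `posDefTr_of_mul_eq_one_sub_of_le` (`⟨A, RA⟩_w ≤ θ⟨A, A⟩_w`, `θ < 1`).
* §2 GENERIC LOCALISATION ALGEBRA for any `T : End_ℂ (X → M_N(ℂ))`, 0∕1 cut-offs `χ_c` (`cutMulY χ_c` idempotent) and real cut-offs `h_c` with
  `supp h_c ⊆ {χ_c = 1}`: `trIP_cutMulY_right_gen` (real multipliers are symmetric), `cutMulY_mul_self_of_zero_one`, ★ `trIP_dirPadY_cutMulY_eq` +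
  `posDefTr_dirPadY_cutMulY` (compression by a 0∕1 cut-off PRESERVES `PosDefTr` — the carrier-generic twin of `B9Thm311LocalInversePosY` §2),
  `cutMulY_mul_T_mul_dirInvY_mul_cutMulY` (`h T G_□ h = h²`), `sum_cutMulY_sq` (`Σ_c M_{h_c}² = 1`), ★★ `mul_localSum_eq_one_sub` (**(3.88)∕(3.105) FOR AN
  ARBITRARY OPERATOR**: `T · Σ_c M_{h_c} G_c M_{h_c} = 1 − Σ_c (M_{h_c}T − T M_{h_c}) G_c M_{h_c}`, `G_c = dirInvY (M_{χ_c}) T`, under `IsUnit (dirPadY (M_{χ_c}) T)`),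
  `trIP_localInv_self_nonneg ∕ _pos` and ★★ `posDefTr_localSum_of_local` (`G₀ = Σ_c M_{h_c} G_c M_{h_c}` is `PosDefTr` as soon as every compressed
  `dirPadY (M_{χ_c}) T` is — «by (3.87) it is enough to prove a positivity of the operators G_□»).
* §3 ★★★ `posDefTr_of_local_posDefTr_of_small`: `IsSymmTr w T` + (∀ c, `PosDefTr w (dirPadY (M_{χ_c}) T)`) + (`⟨A, R_T A⟩_w ≤ θ⟨A, A⟩_w`, `θ < 1`) with
  `R_T := Σ_c (M_{h_c}T − T M_{h_c})·G_c·M_{h_c}` ⇒ `PosDefTr w T` — Theorem 3.11's proof for one operator, every non-analytic step discharged.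
* §4 ★★★ THE ROW-17 FACE `deltaAY_parSymY_posDefTr_of_local`: at def-Y's letters, for `G ≤ U(N)` and a `G`-valued `U`, the certificate's
  `PosDefTr 1 (deltaAY i (parSymY i) (parBY i) (GpY i (parSymY i)) U)` follows from the two displayed analytic inputs ALONE (symmetry by
  `B9Thm311Curv2Symm.deltaAY_isSymmTr` with `symm0_parSymY`, `adj_parSymY`, `parBY_mem`); and `isUnit_deltaAY_parSymY_of_local`, `GAY_parSymY_posDefTr_of_local`.

HONEST SCOPE.  (i) The two inputs of §3–§4 ARE the analytic content of Theorem 3.11 for `Δ_a` and stay HYPOTHESES: positivity of the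
DIRICHLET COMPRESSIONS `M_χ Δ_a(U) M_χ + 1 − M_χ` OF THE FULL `Δ_a(U)` (false without (3.35) — `B9Thm311DeltaAFrustratedWitness`) and the L²-form
smallness of the (3.88)-SHAPED commutator remainder `Σ_c [M_{h_c}, Δ_a(U)] G_c M_{h_c}` (its `D R(U) D*` part, `(h(x) − h(y))·(DRD*)(x, y)`, needs `R(U)`'s
kernel decay and `|∂h_□| = O(M⁻¹)`); nothing of either is proved or asserted.  LOCALISATION MISMATCH, STATED (v1.1, referee ref-A READ-2 of p606819,
WATCH-ROW17-LOCALISATION-MISMATCH): these are NOT literally print's objects — print's (3.105)–(3.106) localise the GAUGE PROJECTION `P → P_□` (local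
`R_□` built from the local `G′_□`, `C_□` on `{Ω_n(□)}`), so print's local operators `Δ_{a,□}(U)` differ from the compressions used here by
`D(R(U) − R_□(U))D*` and print's `R` carries three further `ζ`-terms; the positivity print invokes is Cor. 3.6 for THOSE operators.  The §1 engine
`posDefTr_of_mul_eq_one_sub` is shape-agnostic (any `G₀`, `R` with `T·G₀ = 1 − R`) and covers print's version verbatim; §2–§4 are its
Dirichlet-compression instance.  A consumer discharging `hΔA` on this road must either prove the two inputs for the compressions directly or
re-type §3 with `P_□`-localised operators — an un-printed bridging step either way, to be STATED where claimed.  Wherever §3–§4's docstrings say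
«the local operators of (3.106); Cor. 3.6's content», read «Dirichlet compressions of the full Δ_a(U) — the (3.88)-shaped localisation».  (ii) The cut-offs, cubes and
their number are parameters (print: the partition {h_□} of [4] Sect. A and □̃); no geometry is used.  (iii) `𝔸 = M_N(ℂ)`, trace pairing; §4 at
`parSymY ∕ parBY ∕ GpY` (the certificate's pins).  Count-neutral (no new named fact; N06 NOT discharged; `hΔA` stays displayed); nothing continuum,
nothing about OS axioms or the mass gap.  No `sorry`, no `axiom`, no `instance`, no `notation`.  Seat `pub-ymgap-dag-n06-j` (bundle F5, rows 15–17),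
gen 20, 2026-08-28; NEW file; its one import is this lineage's `B9Thm311LocalInversePosY` (p606285), through which `B9Thm311Whole` (the
abstract engine), `B9Thm311SymmAtRecordV4` ∕ `B9Thm311Curv2Symm` (symmetry) and def-Y's `Node00.OpsYLocalInverse` (local inverses) arrive; modifies nothing.
v1.1 (same seat, same day): DOC-ONLY — the HONEST SCOPE clause (i) re-worded per ref-A's READ-2; every declaration byte-identical.
-/

noncomputable section

namespace Literature.MathematicalPhysics.QuantumFieldTheory.Balaban1983to89.B9Thm311PosViaLocalInversesY

open B9Thm311ReadingCoords B9Thm311DeltaPrimePos B9Thm311LocalInversePosY Node00 Node00.OpsYLocalInverse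
open B9Thm37CubeCoverCommutators (cutMulY cutMulY_apply cutMulY_mul cutMulY_one)
open B6KLevelCensusIndexV1 (KIdx)
open scoped Matrix Matrix.Norms.L2Operator

/-! ## §1 The p. 416 step: positivity from a positive local approximant and a small remainder -/

section Abstract

variable {V : Type*} [NormedAddCommGroup V] [InnerProductSpace ℝ V] [FiniteDimensional ℝ V]

/-- **p. 416 for `Δ = G⁻¹` (abstract, sqrt-free)**: on a finite-dimensional real inner-product space, `T` symmetric, `G₀` positive definite,
`T ∘ G₀ = 1 − R` and `⟨B, RB⟩ < ⟨B, B⟩` for `B ≠ 0` ⇒ `T` positive definite.  (`1 − R` is injective hence bijective, so `T` is onto hence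
bijective; its inverse `G` is symmetric with `G₀ = G ∘ (1 − R)`, positive definite by `B9Thm311Whole.posDef_of_factor_small`, and `T` is a right
inverse of `G`.) [cite: Balaban1985BackgroundPropagators, Thm 3.11 proof p.416, (3.105)–(3.106) p.414] -/
theorem posDef_of_comp_eq_one_sub (T G₀ R : V →ₗ[ℝ] V) (hT : ∀ x y : V, inner ℝ (T x) y = inner ℝ x (T y))
    (hG₀ : B9Thm311Data.PosDef G₀) (hfac : T ∘ₗ G₀ = 1 - R) (hR : ∀ B : V, B ≠ 0 → inner ℝ B (R B) < inner ℝ B B) :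
    B9Thm311Data.PosDef T := by
  -- `1 − R` is injective, hence surjective
  have hinj : Function.Injective (1 - R : V →ₗ[ℝ] V) := by
    intro B₁ B₂ h
    by_contra hne
    have hB : B₁ - B₂ ≠ 0 := sub_ne_zero.mpr hne
    have h0 : (1 - R) (B₁ - B₂) = 0 := by rw [map_sub, h, sub_self]
    have hRB : R (B₁ - B₂) = B₁ - B₂ := by
      rw [LinearMap.sub_apply, Module.End.one_apply, sub_eq_zero] at h0
      exact h0.symm
    have hlt := hR (B₁ - B₂) hB
    rw [hRB] at hlt
    exact lt_irrefl _ hlt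
  have hsurjR : Function.Surjective (1 - R : V →ₗ[ℝ] V) := LinearMap.injective_iff_surjective.mp hinj
  -- `T` is surjective (`T ∘ G₀ = 1 − R` is), hence bijective
  have hsurjT : Function.Surjective T := by
    intro y
    obtain ⟨x, hx⟩ := hsurjR y
    refine ⟨G₀ x, ?_⟩
    rw [← LinearMap.comp_apply, hfac, hx]
  have hinjT : Function.Injective T := LinearMap.injective_iff_surjective.mpr hsurjT
  -- the inverse `G`
  let e : V ≃ₗ[ℝ] V := LinearEquiv.ofBijective T ⟨hinjT, hsurjT⟩
  have he : ∀ x, e x = T x := fun x => rfl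
  let G : V →ₗ[ℝ] V := e.symm.toLinearMap
  have hGT : ∀ x, G (T x) = x := fun x => by
    change e.symm (T x) = x
    rw [← he, LinearEquiv.symm_apply_apply]
  have hTG : ∀ y, T (G y) = y := fun y => by
    change T (e.symm y) = y
    rw [← he, LinearEquiv.apply_symm_apply]
  -- `G` is symmetric
  have hGs : ∀ x y : V, inner ℝ (G x) y = inner ℝ x (G y) := fun x y => by
    conv_lhs => rw [← hTG y]
    rw [← hT, hTG]
  -- `G₀ = G ∘ (1 − R)`
  have hfac' : G₀ = G ∘ₗ (1 - R) := by
    refine LinearMap.ext fun x => ?_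
    rw [LinearMap.comp_apply, ← hfac, LinearMap.comp_apply, hGT]
  have hGpos : B9Thm311Data.PosDef G := B9Thm311Whole.posDef_of_factor_small G G₀ R hGs hG₀ hfac' hR
  exact B9Thm311Whole.posDef_of_rightInverse hGpos hGT

end Abstract

section Trace

variable {X : Type} [Fintype X] {N : ℕ} {w : X → ℝ}

/-- ★ **THE p. 416 STEP IN GENUINE CURRENCY**: on a finite carrier `X` with print's pairing `⟨·,·⟩_w` (`w > 0`), a trIP-SYMMETRIC `T`, a POSITIVE
DEFINITE `G₀` with `T·G₀ = 1 − R` and `⟨A, RA⟩_w < ⟨A, A⟩_w` for `A ≠ 0` ⇒ `T` is positive definite.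
[cite: Balaban1985BackgroundPropagators, Thm 3.11 proof p.416, (3.105)–(3.106) p.414] -/
theorem posDefTr_of_mul_eq_one_sub (hw : ∀ s, 0 < w s)
    {T G₀ R : Module.End ℂ (X → Matrix (Fin N) (Fin N) ℂ)} (hT : IsSymmTr w T) (hG₀ : PosDefTr w G₀)
    (hfac : T * G₀ = 1 - R) (hR : ∀ A : X → Matrix (Fin N) (Fin N) ℂ, A ≠ 0 → trIP w A (R A) < trIP w A A) :
    PosDefTr w T := by
  let e := realify311 (n := Fin N) w hw
  rw [← posDef_conj311_realify311_iff (hw := hw)]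
  have hT' := (symm_conj311_realify311_iff (hw := hw) T).mpr hT
  have hG₀' := (posDef_conj311_realify311_iff (hw := hw) G₀).mpr hG₀
  refine posDef_of_comp_eq_one_sub (conj311 e e T) (conj311 e e G₀) (conj311 e e R) hT' hG₀' ?_ ?_
  · refine LinearMap.ext fun v => ?_
    have h := congrArg (fun S : Module.End ℂ (X → Matrix (Fin N) (Fin N) ℂ) => e (S (e.symm v))) hfac
    simpa [conj311_apply, Module.End.mul_apply] using h
  · intro B hB
    have hA : e.symm B ≠ 0 := fun h0 => hB (by simpa using congrArg e h0)
    have h := hR (e.symm B) hA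
    rw [← inner_realify311 (w := w) (hw := hw), ← inner_realify311 (w := w) (hw := hw)] at h
    simpa [conj311_apply, e] using h

/-- the θ-form: `⟨A, RA⟩_w ≤ θ⟨A, A⟩_w` with `θ < 1` suffices (print's «(1 − O(M^{−1/2}))⟨A, A⟩ > 0 for M sufficiently large»).
[cite: Balaban1985BackgroundPropagators, Thm 3.11 proof p.416] -/
theorem posDefTr_of_mul_eq_one_sub_of_le (hw : ∀ s, 0 < w s)
    {T G₀ R : Module.End ℂ (X → Matrix (Fin N) (Fin N) ℂ)} (hT : IsSymmTr w T) (hG₀ : PosDefTr w G₀)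
    (hfac : T * G₀ = 1 - R) {θ : ℝ} (hθ : θ < 1) (hR : ∀ A : X → Matrix (Fin N) (Fin N) ℂ, trIP w A (R A) ≤ θ * trIP w A A) :
    PosDefTr w T :=
  posDefTr_of_mul_eq_one_sub hw hT hG₀ hfac fun A hA =>
    lt_of_le_of_lt (hR A) (by
      have hpos := trIP_self_pos w hw hA
      nlinarith)

end Trace

/-! ## §2 Localisation algebra for an arbitrary operator: 0∕1 cut-offs, local inverses, (3.88)∕(3.105), positivity of `G₀` -/

section Multipliers

variable {X : Type} {N : ℕ}

/-- a 0∕1 cut-off multiplies idempotently: `M_χ M_χ = M_χ`. [cite: Balaban1985BackgroundPropagators, (3.79) p.406 (□̃), bookkeeping] -/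
theorem cutMulY_mul_self_of_zero_one {χ : X → ℝ} (hχ : ∀ z, χ z = 0 ∨ χ z = 1) :
    cutMulY (𝔸 := Matrix (Fin N) (Fin N) ℂ) χ * cutMulY χ = cutMulY χ := by
  rw [cutMulY_mul]
  refine congrArg cutMulY (funext fun z => ?_)
  rcases hχ z with h | h <;> simp [h]

/-- the complement of a 0∕1 cut-off is the 0∕1 cut-off `1 − χ`: `1 − M_χ = M_{1−χ}`. [cite: Balaban1985BackgroundPropagators, (3.79) p.406, bookkeeping] -/
theorem one_sub_cutMulY (χ : X → ℝ) :
    (1 : Module.End ℂ (X → Matrix (Fin N) (Fin N) ℂ)) - cutMulY χ = cutMulY (fun z => 1 - χ z) := by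
  refine LinearMap.ext fun Λ => funext fun z => ?_
  rw [LinearMap.sub_apply, Module.End.one_apply, Pi.sub_apply, cutMulY_apply, cutMulY_apply, Complex.ofReal_sub, Complex.ofReal_one,
    sub_smul, one_smul]

/-- a cut-off supported where `χ = 1` absorbs `M_χ`: `M_h M_χ = M_h`. [cite: Balaban1985BackgroundPropagators, (3.87) p.409 (supp h_□ ⊂ □̃), bookkeeping] -/
theorem cutMulY_mul_cutMulY_of_support (h χ : X → ℝ) (hsupp : ∀ z, h z ≠ 0 → χ z = 1) :
    cutMulY (𝔸 := Matrix (Fin N) (Fin N) ℂ) h * cutMulY χ = cutMulY h := by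
  rw [cutMulY_mul]
  refine congrArg cutMulY (funext fun z => ?_)
  by_cases hz : h z = 0
  · rw [hz, zero_mul]
  · rw [hsupp z hz, mul_one]

/-- and on the other side: `M_χ M_h = M_h`. [cite: Balaban1985BackgroundPropagators, (3.87) p.409, bookkeeping] -/
theorem cutMulY_mul_cutMulY_of_support' (h χ : X → ℝ) (hsupp : ∀ z, h z ≠ 0 → χ z = 1) :
    cutMulY (𝔸 := Matrix (Fin N) (Fin N) ℂ) χ * cutMulY h = cutMulY h := by
  rw [cutMulY_mul]
  refine congrArg cutMulY (funext fun z => ?_)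
  by_cases hz : h z = 0
  · rw [hz, mul_zero]
  · rw [hsupp z hz, one_mul]

/-- `Φ = M_χΦ + M_{1−χ}Φ`. [cite: Balaban1985BackgroundPropagators, (3.79) p.406, bookkeeping] -/
theorem cutMulY_add_compl (χ : X → ℝ) (Φ : X → Matrix (Fin N) (Fin N) ℂ) :
    cutMulY χ Φ + cutMulY (fun z => 1 - χ z) Φ = Φ := by
  funext z
  rw [Pi.add_apply, cutMulY_apply, cutMulY_apply, ← add_smul, ← Complex.ofReal_add, add_sub_cancel, Complex.ofReal_one, one_smul]

/-- **the local-inverse property `h T G_□ h = h²`** for ANY operator `T`, a 0∕1 cut-off `χ` with `IsUnit (M_χ T M_χ + 1 − M_χ)` and a real cut-off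
`h` supported where `χ = 1` (`G_□ = dirInvY (M_χ) T`). [cite: Balaban1985BackgroundPropagators, (3.87)–(3.88) p.409, (3.105) p.414, (3.79) p.406] -/
theorem cutMulY_mul_T_mul_dirInvY_mul_cutMulY {χ : X → ℝ} (hχ : ∀ z, χ z = 0 ∨ χ z = 1)
    {T : Module.End ℂ (X → Matrix (Fin N) (Fin N) ℂ)} (hU : IsUnit (dirPadY (cutMulY χ) T))
    (h : X → ℝ) (hsupp : ∀ z, h z ≠ 0 → χ z = 1) :
    cutMulY h * T * dirInvY (cutMulY χ) T * cutMulY h = cutMulY h * cutMulY h := by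
  have hP := cutMulY_mul_self_of_zero_one (N := N) hχ
  rw [← cutMulY_mul_cutMulY_of_support (N := N) h χ hsupp, mul_assoc (cutMulY h) (cutMulY χ) T,
    mul_assoc (cutMulY h) (cutMulY χ * T) (dirInvY (cutMulY χ) T), P_mul_T_mul_dirInvY hP hU,
    mul_assoc (cutMulY h) (cutMulY χ) (cutMulY h * cutMulY χ), ← mul_assoc (cutMulY χ) (cutMulY h) (cutMulY χ),
    cutMulY_mul_cutMulY_of_support' (N := N) h χ hsupp]

/-- a finite sum of real multipliers is the multiplier of the sum. [cite: Balaban1985BackgroundPropagators, (3.87) p.409 («Σ h_□² = 1»), bookkeeping] -/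
theorem sum_cutMulY {ι : Type} (s : Finset ι) (g : ι → X → ℝ) :
    ∑ c ∈ s, cutMulY (𝔸 := Matrix (Fin N) (Fin N) ℂ) (g c) = cutMulY (fun z => ∑ c ∈ s, g c z) := by
  refine LinearMap.ext fun Λ => funext fun z => ?_
  rw [LinearMap.sum_apply, Finset.sum_apply, cutMulY_apply, Complex.ofReal_sum, Finset.sum_smul]
  refine Finset.sum_congr rfl fun c _ => ?_
  rw [cutMulY_apply]

/-- `Σ_c M_{h_c}² = 1` for a real family with `Σ_c h_c² = 1`. [cite: Balaban1985BackgroundPropagators, (3.87) p.409 («Σ h_□² = 1»)] -/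
theorem sum_cutMulY_sq {ι : Type} [Fintype ι] (hf : ι → X → ℝ) (hsq : ∀ z, ∑ c, hf c z ^ 2 = 1) :
    ∑ c, cutMulY (𝔸 := Matrix (Fin N) (Fin N) ℂ) (hf c) * cutMulY (hf c) = 1 := by
  simp_rw [cutMulY_mul]
  rw [sum_cutMulY, ← cutMulY_one]
  refine congrArg cutMulY (funext fun z => ?_)
  rw [← hsq z]
  exact Finset.sum_congr rfl fun c _ => (sq (hf c z)).symm

/-- ★★ **(3.88)∕(3.105) FOR AN ARBITRARY OPERATOR**: with `G_c := dirInvY (M_{χ_c}) T` and `G₀ := Σ_c M_{h_c} G_c M_{h_c}`,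
`T · G₀ = 1 − Σ_c (M_{h_c}T − T M_{h_c})·G_c·M_{h_c}` — the remainder is the sum of COMMUTATOR terms `K(h_c) G_c h_c`.
[cite: Balaban1985BackgroundPropagators, (3.88) p.409, (3.105) p.414] -/
theorem mul_localSum_eq_one_sub {ι : Type} [Fintype ι] (T : Module.End ℂ (X → Matrix (Fin N) (Fin N) ℂ))
    (hf : ι → X → ℝ) (hsq : ∀ z, ∑ c, hf c z ^ 2 = 1) (χ : ι → X → ℝ) (hχ : ∀ c z, χ c z = 0 ∨ χ c z = 1)
    (hsupp : ∀ c z, hf c z ≠ 0 → χ c z = 1) (hU : ∀ c, IsUnit (dirPadY (cutMulY (χ c)) T)) :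
    T * (∑ c, cutMulY (hf c) * dirInvY (cutMulY (χ c)) T * cutMulY (hf c))
      = 1 - ∑ c, (cutMulY (hf c) * T - T * cutMulY (hf c)) * dirInvY (cutMulY (χ c)) T * cutMulY (hf c) := by
  rw [Finset.mul_sum, eq_sub_iff_add_eq, ← Finset.sum_add_distrib, ← sum_cutMulY_sq (N := N) hf hsq]
  refine Finset.sum_congr rfl fun c _ => ?_
  rw [← cutMulY_mul_T_mul_dirInvY_mul_cutMulY (hχ c) (hU c) (hf c) (hsupp c), sub_mul, sub_mul,
    ← mul_assoc T (cutMulY (hf c) * dirInvY (cutMulY (χ c)) T) (cutMulY (hf c)),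
    ← mul_assoc T (cutMulY (hf c)) (dirInvY (cutMulY (χ c)) T)]
  abel

/-- a partition of unity `Σ_c h_c² = 1` that kills `Ψ` cut-off-wise kills `Ψ` (any carrier). [cite: Balaban1985BackgroundPropagators, (3.87) p.409, bookkeeping] -/
theorem eq_zero_of_cutMulY_eq_zero_gen {ι : Type} [Fintype ι] (hf : ι → X → ℝ) (hsq : ∀ z, ∑ c, hf c z ^ 2 = 1)
    {Ψ : X → Matrix (Fin N) (Fin N) ℂ} (h0 : ∀ c, cutMulY (hf c) Ψ = 0) : Ψ = 0 := by
  funext z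
  have hz : ∀ c, ((hf c z : ℝ) : ℂ) • Ψ z = 0 := fun c => by
    have := congrFun (h0 c) z
    rwa [cutMulY_apply] at this
  have hsum : (∑ c, (((hf c z) ^ 2 : ℝ) : ℂ)) • Ψ z = 0 := by
    rw [Finset.sum_smul]
    refine Finset.sum_eq_zero fun c _ => ?_
    rw [Complex.ofReal_pow, sq, ← smul_smul, hz c, smul_zero]
  rw [← Complex.ofReal_sum, hsq z, Complex.ofReal_one, one_smul] at hsum
  exact hsum

end Multipliers

section Local

variable {X : Type} [Fintype X] {N : ℕ}

/-- a REAL multiplier is symmetric for print's pairing on any carrier: `⟨Φ, hΨ⟩_w = ⟨hΦ, Ψ⟩_w`.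
[cite: Balaban1985BackgroundPropagators, (3.87) p.409 (real h_□), p.393, bookkeeping] -/
theorem trIP_cutMulY_right_gen (w : X → ℝ) (h : X → ℝ) (Φ Ψ : X → Matrix (Fin N) (Fin N) ℂ) :
    trIP w Φ (cutMulY h Ψ) = trIP w (cutMulY h Φ) Ψ := by
  unfold trIP
  refine Finset.sum_congr rfl fun s _ => ?_
  congr 1
  refine Finset.sum_congr rfl fun a _ => Finset.sum_congr rfl fun b _ => ?_
  rw [cutMulY_apply, cutMulY_apply, Matrix.smul_apply, Matrix.smul_apply, smul_eq_mul, smul_eq_mul, star_mul',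
    Complex.star_def, Complex.conj_ofReal]
  ring_nf

/-- two real multipliers: `⟨hΦ, hΨ⟩_w = ⟨Φ, h²Ψ⟩_w`. [cite: Balaban1985BackgroundPropagators, (3.87) p.409, bookkeeping] -/
theorem trIP_cutMulY_cutMulY (w : X → ℝ) (h : X → ℝ) (Φ Ψ : X → Matrix (Fin N) (Fin N) ℂ) :
    trIP w (cutMulY h Φ) (cutMulY h Ψ) = trIP w Φ (cutMulY (fun z => h z * h z) Ψ) := by
  rw [← trIP_cutMulY_right_gen, ← cutMulY_mul, Module.End.mul_apply]

/-- the pairing is additive in its right slot over finite sums (any carrier). [cite: Balaban1985BackgroundPropagators, p.393, bookkeeping] -/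
theorem trIP_sum_right_gen {ι : Type} (w : X → ℝ) (Φ : X → Matrix (Fin N) (Fin N) ℂ) (s : Finset ι)
    (Ψ : ι → X → Matrix (Fin N) (Fin N) ℂ) : trIP w Φ (∑ c ∈ s, Ψ c) = ∑ c ∈ s, trIP w Φ (Ψ c) := by
  classical
  induction s using Finset.induction_on with
  | empty => simp
  | insert c s hc ih => rw [Finset.sum_insert hc, Finset.sum_insert hc, trIP_add_right, ih]

/-- the padded compression by a 0∕1 cut-off, on the pairing: `⟨Φ, (M_χ T M_χ + 1 − M_χ)Φ⟩_w = ⟨M_χΦ, T M_χΦ⟩_w + ⟨M_{1−χ}Φ, M_{1−χ}Φ⟩_w`.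
[cite: Balaban1985BackgroundPropagators, (3.79) p.406, bookkeeping] -/
theorem trIP_dirPadY_cutMulY_eq (w : X → ℝ) {χ : X → ℝ} (hχ : ∀ z, χ z = 0 ∨ χ z = 1)
    (T : Module.End ℂ (X → Matrix (Fin N) (Fin N) ℂ)) (Φ : X → Matrix (Fin N) (Fin N) ℂ) :
    trIP w Φ (dirPadY (cutMulY χ) T Φ)
      = trIP w (cutMulY χ Φ) (T (cutMulY χ Φ)) + trIP w (cutMulY (fun z => 1 - χ z) Φ) (cutMulY (fun z => 1 - χ z) Φ) := by
  have hχ' : ∀ z, (1 - χ z) = 0 ∨ (1 - χ z) = 1 := fun z => by rcases hχ z with h | h <;> simp [h]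
  rw [dirPadY, one_sub_cutMulY, LinearMap.add_apply, Module.End.mul_apply, Module.End.mul_apply, trIP_add_right,
    trIP_cutMulY_right_gen, trIP_cutMulY_cutMulY w (fun z => 1 - χ z)]
  congr 1
  refine congrArg (trIP w Φ) ?_
  have := cutMulY_mul_self_of_zero_one (N := N) hχ'
  rw [cutMulY_mul] at this
  exact (congrArg (fun S : Module.End ℂ (X → Matrix (Fin N) (Fin N) ℂ) => S Φ) this).symm

/-- ★ **COMPRESSION BY A 0∕1 CUT-OFF PRESERVES POSITIVE DEFINITENESS** (any carrier, any weight `w > 0`, any `T`).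
[cite: Balaban1985BackgroundPropagators, Thm 3.11 p.416 («enough to prove a positivity of the operators G_□»), (3.79) p.406] -/
theorem posDefTr_dirPadY_cutMulY {w : X → ℝ} (hw : ∀ s, 0 < w s) {χ : X → ℝ} (hχ : ∀ z, χ z = 0 ∨ χ z = 1)
    {T : Module.End ℂ (X → Matrix (Fin N) (Fin N) ℂ)} (hT : PosDefTr w T) : PosDefTr w (dirPadY (cutMulY χ) T) := by
  intro Φ hΦ
  rw [trIP_dirPadY_cutMulY_eq w hχ]
  by_cases hP : cutMulY χ Φ = 0
  · have hrest : cutMulY (fun z => 1 - χ z) Φ = Φ := by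
      have := cutMulY_add_compl (N := N) χ Φ
      rwa [hP, zero_add] at this
    rw [hP, map_zero, trIP_zero_right, zero_add, hrest]
    exact trIP_self_pos w hw hΦ
  · exact add_pos_of_pos_of_nonneg (hT _ hP) (trIP_self_nonneg w hw _)

/-- the unit property follows. [cite: Balaban1985BackgroundPropagators, (3.79) p.406, (3.25) p.395] -/
theorem isUnit_dirPadY_cutMulY {w : X → ℝ} (hw : ∀ s, 0 < w s) {χ : X → ℝ} (hχ : ∀ z, χ z = 0 ∨ χ z = 1)
    {T : Module.End ℂ (X → Matrix (Fin N) (Fin N) ℂ)} (hT : PosDefTr w T) : IsUnit (dirPadY (cutMulY χ) T) :=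
  isUnit_of_posDefTr (posDefTr_dirPadY_cutMulY hw hχ hT)

/-- the form of a local inverse: `⟨Ψ, G_□Ψ⟩_w = ⟨M_χΨ, (padded)⁻¹ M_χΨ⟩_w`. [cite: Balaban1985BackgroundPropagators, (3.79) p.406, bookkeeping] -/
theorem trIP_localInv_eq (w : X → ℝ) (χ : X → ℝ) (T : Module.End ℂ (X → Matrix (Fin N) (Fin N) ℂ))
    (Ψ : X → Matrix (Fin N) (Fin N) ℂ) :
    trIP w Ψ (dirInvY (cutMulY χ) T Ψ) = trIP w (cutMulY χ Ψ) (Ring.inverse (dirPadY (cutMulY χ) T) (cutMulY χ Ψ)) := by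
  rw [dirInvY, Module.End.mul_apply, Module.End.mul_apply, trIP_cutMulY_right_gen]

/-- ★ a local inverse is `≥ 0` as soon as its padded compression is positive definite. [cite: Balaban1985BackgroundPropagators, Thm 3.11 p.416 («positivity of the operators G_□»)] -/
theorem trIP_localInv_self_nonneg {w : X → ℝ} {χ : X → ℝ} {T : Module.End ℂ (X → Matrix (Fin N) (Fin N) ℂ)}
    (hloc : PosDefTr w (dirPadY (cutMulY χ) T)) (Ψ : X → Matrix (Fin N) (Fin N) ℂ) :
    0 ≤ trIP w Ψ (dirInvY (cutMulY χ) T Ψ) := by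
  rw [trIP_localInv_eq]
  by_cases hP : cutMulY χ Ψ = 0
  · rw [hP, map_zero, trIP_zero_right]
  · exact (posDefTr_ringInverse hloc _ hP).le

/-- ★ and `> 0` on arguments meeting the cube. [cite: Balaban1985BackgroundPropagators, Thm 3.11 p.416] -/
theorem trIP_localInv_self_pos {w : X → ℝ} {χ : X → ℝ} {T : Module.End ℂ (X → Matrix (Fin N) (Fin N) ℂ)}
    (hloc : PosDefTr w (dirPadY (cutMulY χ) T)) {Ψ : X → Matrix (Fin N) (Fin N) ℂ} (hΨ : cutMulY χ Ψ ≠ 0) :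
    0 < trIP w Ψ (dirInvY (cutMulY χ) T Ψ) := by
  rw [trIP_localInv_eq]
  exact posDefTr_ringInverse hloc _ hΨ

/-- ★★ **`G₀ = Σ_c M_{h_c} G_c M_{h_c}` IS POSITIVE DEFINITE AS SOON AS EVERY LOCAL COMPRESSION IS** («by the definition (3.87) it is enough to prove a
positivity of the operators G_□»), for any operator `T`, any weight `w > 0`, any real family `Σ_c h_c² = 1` with `supp h_c ⊆ {χ_c = 1}`.
[cite: Balaban1985BackgroundPropagators, Thm 3.11 proof p.416, (3.87) p.409] -/
theorem posDefTr_localSum_of_local {w : X → ℝ} {ι : Type} [Fintype ι] (T : Module.End ℂ (X → Matrix (Fin N) (Fin N) ℂ))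
    (hf : ι → X → ℝ) (hsq : ∀ z, ∑ c, hf c z ^ 2 = 1) (χ : ι → X → ℝ)
    (hsupp : ∀ c z, hf c z ≠ 0 → χ c z = 1) (hloc : ∀ c, PosDefTr w (dirPadY (cutMulY (χ c)) T)) :
    PosDefTr w (∑ c, cutMulY (hf c) * dirInvY (cutMulY (χ c)) T * cutMulY (hf c)) := by
  intro Ψ hΨ
  have hsum : trIP w Ψ ((∑ c, cutMulY (hf c) * dirInvY (cutMulY (χ c)) T * cutMulY (hf c) :
        Module.End ℂ (X → Matrix (Fin N) (Fin N) ℂ)) Ψ)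
      = ∑ c, trIP w (cutMulY (hf c) Ψ) (dirInvY (cutMulY (χ c)) T (cutMulY (hf c) Ψ)) := by
    rw [LinearMap.sum_apply, trIP_sum_right_gen]
    refine Finset.sum_congr rfl fun c _ => ?_
    rw [Module.End.mul_apply, Module.End.mul_apply, trIP_cutMulY_right_gen]
  rw [hsum]
  have hnn : ∀ c ∈ Finset.univ, 0 ≤ trIP w (cutMulY (hf c) Ψ) (dirInvY (cutMulY (χ c)) T (cutMulY (hf c) Ψ)) :=
    fun c _ => trIP_localInv_self_nonneg (hloc c) _
  rcases (Finset.sum_nonneg hnn).lt_or_eq with hlt | heq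
  · exact hlt
  · exfalso
    have hall := (Finset.sum_eq_zero_iff_of_nonneg hnn).mp heq.symm
    refine hΨ (eq_zero_of_cutMulY_eq_zero_gen hf hsq fun c => ?_)
    by_contra hc
    have hPc : cutMulY (χ c) (cutMulY (hf c) Ψ) ≠ 0 := by
      have hcomm := cutMulY_mul_cutMulY_of_support' (N := N) (hf c) (χ c) (hsupp c)
      rwa [← Module.End.mul_apply, hcomm]
    exact (trIP_localInv_self_pos (hloc c) hPc).ne' (hall c (Finset.mem_univ c))

end Local

/-! ## §3 Theorem 3.11's proof for one symmetric operator: local positivity + small remainder ⇒ positive definite -/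

section Assembly

variable {X : Type} [Fintype X] {N : ℕ}

/-- ★★★ **THEOREM 3.11's LOCALISATION ROAD, EVERY NON-ANALYTIC STEP DISCHARGED**: on any finite carrier with print's pairing (`w > 0`), a
trIP-symmetric operator `T` is POSITIVE DEFINITE as soon as (i) every compression `M_{χ_c} T M_{χ_c} + 1 − M_{χ_c}` to the cubes of a partition
(`Σ_c h_c² = 1`, `supp h_c ⊆ {χ_c = 1}`, `χ_c` 0∕1-valued) is positive definite, and (ii) the localisation remainder
`R = Σ_c (M_{h_c}T − T M_{h_c})·G_c·M_{h_c}` (`G_c` the local inverses) satisfies `⟨A, RA⟩_w ≤ θ⟨A, A⟩_w` with `θ < 1`.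
[cite: Balaban1985BackgroundPropagators, Thm 3.11 proof p.416, (3.87)–(3.88) p.409, (3.105)–(3.106) p.414] -/
theorem posDefTr_of_local_posDefTr_of_small {w : X → ℝ} (hw : ∀ s, 0 < w s) {ι : Type} [Fintype ι]
    {T : Module.End ℂ (X → Matrix (Fin N) (Fin N) ℂ)} (hT : IsSymmTr w T)
    (hf : ι → X → ℝ) (hsq : ∀ z, ∑ c, hf c z ^ 2 = 1) (χ : ι → X → ℝ) (hχ : ∀ c z, χ c z = 0 ∨ χ c z = 1)
    (hsupp : ∀ c z, hf c z ≠ 0 → χ c z = 1) (hloc : ∀ c, PosDefTr w (dirPadY (cutMulY (χ c)) T)) {θ : ℝ} (hθ : θ < 1)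
    (hsmall : ∀ A : X → Matrix (Fin N) (Fin N) ℂ,
      trIP w A ((∑ c, (cutMulY (hf c) * T - T * cutMulY (hf c)) * dirInvY (cutMulY (χ c)) T * cutMulY (hf c) :
        Module.End ℂ (X → Matrix (Fin N) (Fin N) ℂ)) A) ≤ θ * trIP w A A) :
    PosDefTr w T :=
  posDefTr_of_mul_eq_one_sub_of_le hw hT (posDefTr_localSum_of_local T hf hsq χ hsupp hloc)
    (mul_localSum_eq_one_sub T hf hsq χ hχ hsupp fun c => isUnit_of_posDefTr (hloc c)) hθ hsmall

end Assembly

/-! ## §4 The row-17 face at def-Y's letters: `hΔA(U)` from local positivity and the small remainder -/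

section Row17

variable {d ℓ : ℕ} {hd : 1 ≤ d + 1} {hL : Odd (ℓ + 1) ∧ 1 < ℓ + 1} {b₀ b₁ : ℝ} {N : ℕ}
variable (i : KIdx d ℓ hd hL b₀ b₁) {G : Subgroup (Matrix (Fin N) (Fin N) ℂ)ˣ}

/-- def-Y's `Δ_a(U)` at the certificate's transporters is trIP-symmetric at every `G`-valued `U`, `G ≤ U(N)` — this lineage's
`B9Thm311Curv2Symm.deltaAY_isSymmTr` with all four side inputs discharged at `parSymY ∕ parBY`. [cite: Balaban1985BackgroundPropagators, (3.26) p.395, Thm 3.11 p.416 («It is a symmetric … operator»)] -/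
theorem deltaAY_parSymY_isSymmTr (hG : G ≤ B7Prop2Explicit.unitaryUnits (Matrix (Fin N) (Fin N) ℂ))
    {U : CfgY (Matrix (Fin N) (Fin N) ℂ) i} (hU : ∀ μ x, U μ x ∈ G) :
    IsSymmTr (fun _ => (1 : ℝ)) (deltaAY i (parSymY i) (parBY i) (GpY i (parSymY i)) U) :=
  B9Thm311Curv2Symm.deltaAY_isSymmTr i hG (parSymY i) (parBY i) U hU (fun s s' => parBY_mem i hU s s')
    (B9Thm311SymmAtRecordV4.symm0_parSymY i hG hU) (B9Thm311SymmAtRecordV4.adj_parSymY i hG hU)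

/-- ★★★ **ROW 17 BY PRINT's ROAD**: for `G ≤ U(N)` and a `G`-valued `U`, the certificate's `PosDefTr 1 (Δ_a(U))` (binder `hΔA` at `U`) follows from
(i) positivity of every cube compression `M_{χ_c} Δ_a(U) M_{χ_c} + 1 − M_{χ_c}` of `Δ_a(U)` (the local operators of (3.106); Cor. 3.6's content) and
(ii) the L²-form smallness `⟨A, R(U)A⟩₁ ≤ θ⟨A, A⟩₁`, `θ < 1`, of the (3.105) remainder `R(U) = Σ_c (M_{h_c}Δ_a(U) − Δ_a(U)M_{h_c})·G_c(U)·M_{h_c}` —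
NOTHING ELSE (symmetry, the identity (3.105), the invertibility of `1 − R` and the positivity transfer are theorems).
[cite: Balaban1985BackgroundPropagators, Thm 3.11 p.416, (3.105)–(3.106) p.414, (3.87) p.409] -/
theorem deltaAY_parSymY_posDefTr_of_local (hG : G ≤ B7Prop2Explicit.unitaryUnits (Matrix (Fin N) (Fin N) ℂ))
    {U : CfgY (Matrix (Fin N) (Fin N) ℂ) i} (hU : ∀ μ x, U μ x ∈ G) {ι : Type} [Fintype ι]
    (hf : ι → FBondY i → ℝ) (hsq : ∀ b, ∑ c, hf c b ^ 2 = 1) (χ : ι → FBondY i → ℝ) (hχ : ∀ c b, χ c b = 0 ∨ χ c b = 1)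
    (hsupp : ∀ c b, hf c b ≠ 0 → χ c b = 1)
    (hloc : ∀ c, PosDefTr (fun _ => (1 : ℝ)) (dirPadY (cutMulY (χ c)) (deltaAY i (parSymY i) (parBY i) (GpY i (parSymY i)) U)))
    {θ : ℝ} (hθ : θ < 1)
    (hsmall : ∀ A : FBondY i → Matrix (Fin N) (Fin N) ℂ,
      trIP (fun _ => (1 : ℝ)) A ((∑ c, (cutMulY (hf c) * deltaAY i (parSymY i) (parBY i) (GpY i (parSymY i)) U
          - deltaAY i (parSymY i) (parBY i) (GpY i (parSymY i)) U * cutMulY (hf c))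
          * dirInvY (cutMulY (χ c)) (deltaAY i (parSymY i) (parBY i) (GpY i (parSymY i)) U) * cutMulY (hf c) :
        Module.End ℂ (FBondY i → Matrix (Fin N) (Fin N) ℂ)) A) ≤ θ * trIP (fun _ => (1 : ℝ)) A A) :
    PosDefTr (fun _ => (1 : ℝ)) (deltaAY i (parSymY i) (parBY i) (GpY i (parSymY i)) U) :=
  posDefTr_of_local_posDefTr_of_small (fun _ => one_pos) (deltaAY_parSymY_isSymmTr i hG hU) hf hsq χ hχ hsupp hloc hθ hsmall

/-- hence `Δ_a(U)` is a unit and def-Y's `G(U) = GAY` its genuine two-sided inverse, on the same two inputs. [cite: Balaban1985BackgroundPropagators, (3.27) p.395, Thm 3.11 p.416] -/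
theorem isUnit_deltaAY_parSymY_of_local (hG : G ≤ B7Prop2Explicit.unitaryUnits (Matrix (Fin N) (Fin N) ℂ))
    {U : CfgY (Matrix (Fin N) (Fin N) ℂ) i} (hU : ∀ μ x, U μ x ∈ G) {ι : Type} [Fintype ι]
    (hf : ι → FBondY i → ℝ) (hsq : ∀ b, ∑ c, hf c b ^ 2 = 1) (χ : ι → FBondY i → ℝ) (hχ : ∀ c b, χ c b = 0 ∨ χ c b = 1)
    (hsupp : ∀ c b, hf c b ≠ 0 → χ c b = 1)
    (hloc : ∀ c, PosDefTr (fun _ => (1 : ℝ)) (dirPadY (cutMulY (χ c)) (deltaAY i (parSymY i) (parBY i) (GpY i (parSymY i)) U)))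
    {θ : ℝ} (hθ : θ < 1)
    (hsmall : ∀ A : FBondY i → Matrix (Fin N) (Fin N) ℂ,
      trIP (fun _ => (1 : ℝ)) A ((∑ c, (cutMulY (hf c) * deltaAY i (parSymY i) (parBY i) (GpY i (parSymY i)) U
          - deltaAY i (parSymY i) (parBY i) (GpY i (parSymY i)) U * cutMulY (hf c))
          * dirInvY (cutMulY (χ c)) (deltaAY i (parSymY i) (parBY i) (GpY i (parSymY i)) U) * cutMulY (hf c) :
        Module.End ℂ (FBondY i → Matrix (Fin N) (Fin N) ℂ)) A) ≤ θ * trIP (fun _ => (1 : ℝ)) A A) :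
    IsUnit (deltaAY i (parSymY i) (parBY i) (GpY i (parSymY i)) U) :=
  isUnit_of_posDefTr (deltaAY_parSymY_posDefTr_of_local i hG hU hf hsq χ hχ hsupp hloc hθ hsmall)

/-- and print's fifth operator `G(U) = Δ_a(U)⁻¹` (def-Y's `GAY`) is positive definite on the same two inputs.
[cite: Balaban1985BackgroundPropagators, Thm 3.11 p.416 («it is enough to prove it for G»), (3.27) p.395] -/
theorem GAY_parSymY_posDefTr_of_local (hG : G ≤ B7Prop2Explicit.unitaryUnits (Matrix (Fin N) (Fin N) ℂ))
    {U : CfgY (Matrix (Fin N) (Fin N) ℂ) i} (hU : ∀ μ x, U μ x ∈ G) {ι : Type} [Fintype ι]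
    (hf : ι → FBondY i → ℝ) (hsq : ∀ b, ∑ c, hf c b ^ 2 = 1) (χ : ι → FBondY i → ℝ) (hχ : ∀ c b, χ c b = 0 ∨ χ c b = 1)
    (hsupp : ∀ c b, hf c b ≠ 0 → χ c b = 1)
    (hloc : ∀ c, PosDefTr (fun _ => (1 : ℝ)) (dirPadY (cutMulY (χ c)) (deltaAY i (parSymY i) (parBY i) (GpY i (parSymY i)) U)))
    {θ : ℝ} (hθ : θ < 1)
    (hsmall : ∀ A : FBondY i → Matrix (Fin N) (Fin N) ℂ,
      trIP (fun _ => (1 : ℝ)) A ((∑ c, (cutMulY (hf c) * deltaAY i (parSymY i) (parBY i) (GpY i (parSymY i)) U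
          - deltaAY i (parSymY i) (parBY i) (GpY i (parSymY i)) U * cutMulY (hf c))
          * dirInvY (cutMulY (χ c)) (deltaAY i (parSymY i) (parBY i) (GpY i (parSymY i)) U) * cutMulY (hf c) :
        Module.End ℂ (FBondY i → Matrix (Fin N) (Fin N) ℂ)) A) ≤ θ * trIP (fun _ => (1 : ℝ)) A A) :
    PosDefTr (fun _ => (1 : ℝ)) (GAY i (parSymY i) (parBY i) (GpY i (parSymY i)) U) :=
  posDefTr_ringInverse (deltaAY_parSymY_posDefTr_of_local i hG hU hf hsq χ hχ hsupp hloc hθ hsmall)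

end Row17

end Literature.MathematicalPhysics.QuantumFieldTheory.Balaban1983to89.B9Thm311PosViaLocalInversesY

end
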